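import Mathlib
import Literature.Computability.Complexity.CodeFPTableKit
import Summits.PneNP.PneNP.Theorems.Nc03AvoidResidualCoreCandStarProgram

/-!
# Route Nc03AvoidResidualCore, crux `CandStarReduction` (X₂) — the tangled-surplus solver, V: polynomial time

Helper file for `stmt-PneNP-19963` (sequel of `…CandStarProgram`; cell pnp-ideate, rung F-N1b). Every piece of
the program of `…CandStarProgram` is assembled in the tree's typed `CodeFP` algebra
(`Literature/Computability/Complexity/CodeFP*.lean`): pair / triple enumeration by `rawProduct` and `urange`,
the tests by `natEq` / `and` / `or` / `not` / `xor` over `tri` projections, the greedy cherry fold by `foldl₀`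
(accumulator a sublist of the candidates), the derived lists by `map` / `filter` / `mem`, the flip-set search
by `rawFind?` over the span test `Nc03Reduction.codeFP_inSpan` (list Gaussian elimination over `𝔽₂`,
`GaussRank.codeFP_lrank`), the dispatch by `optCases`. Result: **`codeFP_starOut : CodeFP prE (rawE bitE)
starOut`** — the solver is polynomial time on raw pure instances.

Restricted-model (NC⁰₃) range-avoidance rung F-N1b of the PneNP frontier ladder; no bearing on P vs NP.
-/

set_option linter.dupNamespace false -- `Summit.PneNP.PneNP.…`: summit = sub-problem name (D-0017 single-conjunct layout)

namespace Summit.PneNP.PneNP.Theorems.Nc03CandStar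

open Literature.Computability.Complexity CodeFP Nc03Reduction
open Summit.PneNP.PneNP.Theorems.Nc03AvoidResidualCoreCandFewHeadsRungFP (tri)
open Summit.PneNP.PneNP.Theorems.Nc03AvoidResidualCoreCandMatchRungFP (codeFP_triI)

/-! ## Codes -/

/-- Code of an index pair. -/
abbrev pE : ℕ × ℕ → List Bool := pairE natE natE

/-- Code of a cherry list (same triples code as the instance triples). -/
abbrev chE : List (ℕ × ℕ × ℕ) → List Bool := rawE tripE

/-- Code of the context `(triples, cherries)`. -/
abbrev c1E : List (ℕ × ℕ × ℕ) × List (ℕ × ℕ × ℕ) → List Bool := pairE (rawE tripE) chE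

/-- Code of the context `(raw instance, cherries)`. -/
abbrev c2E : PRaw × List (ℕ × ℕ × ℕ) → List Bool := pairE prE chE

variable {α : Type} {eα : α → List Bool}

/-! ## Triples and tests -/

/-- Head of an indexed triple. -/
theorem codeFP_tri0 {gL : α → List (ℕ × ℕ × ℕ)} {gj : α → ℕ} (hL : CodeFP eα (rawE tripE) gL)
    (hj : CodeFP eα natE gj) : CodeFP eα natE (fun a => (tri (gL a) (gj a)).1) := (codeFP_triI hL hj).fst'

/-- First data index of an indexed triple. -/
theorem codeFP_tri1 {gL : α → List (ℕ × ℕ × ℕ)} {gj : α → ℕ} (hL : CodeFP eα (rawE tripE) gL)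
    (hj : CodeFP eα natE gj) : CodeFP eα natE (fun a => (tri (gL a) (gj a)).2.1) := (codeFP_triI hL hj).snd'.fst'

/-- Second data index of an indexed triple. -/
theorem codeFP_tri2 {gL : α → List (ℕ × ℕ × ℕ)} {gj : α → ℕ} (hL : CodeFP eα (rawE tripE) gL)
    (hj : CodeFP eα natE gj) : CodeFP eα natE (fun a => (tri (gL a) (gj a)).2.2) := (codeFP_triI hL hj).snd'.snd'

/-- All index pairs. -/
theorem codeFP_prs : CodeFP unE (rawE pE) prs :=
  ((rawProduct natE natE).comp (urange.pair urange)).congr fun _ => rfl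

/-- The (F1) test. -/
theorem codeFP_parB : CodeFP (pairE (rawE tripE) pE) bitE (fun q => parB q.1 q.2) := by
  have hL : CodeFP (pairE (rawE tripE) pE) (rawE tripE) (fun q => q.1) := fst _ _
  have h1 : CodeFP (pairE (rawE tripE) pE) natE (fun q => q.2.1) := (snd _ _).fst'
  have h2 : CodeFP (pairE (rawE tripE) pE) natE (fun q => q.2.2) := (snd _ _).snd'
  have hne := (codeFP_eqTest h1 h2).not
  have hh := codeFP_eqTest (codeFP_tri0 hL h1) (codeFP_tri0 hL h2)
  have e11 := codeFP_eqTest (codeFP_tri1 hL h1) (codeFP_tri1 hL h2)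
  have e22 := codeFP_eqTest (codeFP_tri2 hL h1) (codeFP_tri2 hL h2)
  have e12 := codeFP_eqTest (codeFP_tri1 hL h1) (codeFP_tri2 hL h2)
  have e21 := codeFP_eqTest (codeFP_tri2 hL h1) (codeFP_tri1 hL h2)
  exact ((hne.and hh).and ((e11.and e22).or (e12.and e21))).congr fun _ => rfl

/-- The (F1) search. -/
theorem codeFP_findPar : CodeFP prE (optE pE) findPar :=
  ((rawFind? (σ := List (ℕ × ℕ × ℕ)) (eσ := rawE tripE) (p := fun q => parB q.1 q.2) codeFP_parB).comp
    (codeFP_trips.pair (codeFP_prs.comp codeFP_M))).congr fun _ => rfl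

/-- The cherry test. -/
theorem codeFP_shareB : CodeFP (pairE (rawE tripE) pE) bitE (fun q => shareB q.1 q.2) := by
  have hL : CodeFP (pairE (rawE tripE) pE) (rawE tripE) (fun q => q.1) := fst _ _
  have h1 : CodeFP (pairE (rawE tripE) pE) natE (fun q => q.2.1) := (snd _ _).fst'
  have h2 : CodeFP (pairE (rawE tripE) pE) natE (fun q => q.2.2) := (snd _ _).snd'
  have hlt : CodeFP (pairE (rawE tripE) pE) bitE (fun q => decide (q.2.1 < q.2.2)) :=
    (natLt.comp (h1.pair h2)).congr fun _ => rfl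
  have hh := codeFP_eqTest (codeFP_tri0 hL h1) (codeFP_tri0 hL h2)
  have e11 := codeFP_eqTest (codeFP_tri1 hL h1) (codeFP_tri1 hL h2)
  have e12 := codeFP_eqTest (codeFP_tri1 hL h1) (codeFP_tri2 hL h2)
  have e21 := codeFP_eqTest (codeFP_tri2 hL h1) (codeFP_tri1 hL h2)
  have e22 := codeFP_eqTest (codeFP_tri2 hL h1) (codeFP_tri2 hL h2)
  exact ((hlt.and hh).and (((e11.or e12).or e21).or e22)).congr fun _ => rfl

/-- The apex with a Boolean test (program form of `apexOf`). -/
def apexOfB (L : List (ℕ × ℕ × ℕ)) (p : ℕ × ℕ) : ℕ :=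
  if (decide ((tri L p.1).2.1 = (tri L p.2).2.1) || decide ((tri L p.1).2.1 = (tri L p.2).2.2)) then (tri L p.1).2.1
  else (tri L p.1).2.2

/-- The Boolean form agrees with `apexOf`. -/
theorem apexOfB_eq (L : List (ℕ × ℕ × ℕ)) (p : ℕ × ℕ) : apexOfB L p = apexOf L p := by
  unfold apexOfB apexOf
  by_cases h : (tri L p.1).2.1 = (tri L p.2).2.1 ∨ (tri L p.1).2.1 = (tri L p.2).2.2
  · rw [if_pos h, if_pos (by simpa using h)]
  · rw [if_neg h, if_neg (by simpa using h)]

/-- The apex. -/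
theorem codeFP_apexOf : CodeFP (pairE (rawE tripE) pE) natE (fun q => apexOf q.1 q.2) := by
  have hL : CodeFP (pairE (rawE tripE) pE) (rawE tripE) (fun q => q.1) := fst _ _
  have h1 : CodeFP (pairE (rawE tripE) pE) natE (fun q => q.2.1) := (snd _ _).fst'
  have h2 : CodeFP (pairE (rawE tripE) pE) natE (fun q => q.2.2) := (snd _ _).snd'
  have hB : CodeFP (pairE (rawE tripE) pE) natE (fun q => apexOfB q.1 q.2) :=
    ((((codeFP_eqTest (codeFP_tri1 hL h1) (codeFP_tri1 hL h2)).or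
      (codeFP_eqTest (codeFP_tri1 hL h1) (codeFP_tri2 hL h2))).ite (codeFP_tri1 hL h1) (codeFP_tri2 hL h1))).congr
      fun _ => rfl
  exact hB.congr fun q => apexOfB_eq q.1 q.2

/-- The cherry candidates. -/
theorem codeFP_cherryCands : CodeFP prE (rawE tripE) cherryCands := by
  have hfilter : CodeFP (pairE (rawE tripE) (rawE pE)) (rawE pE) (fun q => q.2.filter fun a => shareB q.1 a) :=
    filter codeFP_shareB
  have hf : CodeFP (pairE (rawE tripE) pE) tripE (fun q => (apexOf q.1 q.2, q.2.1, q.2.2)) :=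
    codeFP_apexOf.pair ((snd _ _).fst'.pair (snd _ _).snd')
  have hmap : CodeFP (pairE (rawE tripE) (rawE pE)) (rawE tripE)
      (fun q => q.2.map fun a => (apexOf q.1 a, a.1, a.2)) := map hf
  exact (hmap.comp (codeFP_trips.pair (hfilter.comp (codeFP_trips.pair (codeFP_prs.comp codeFP_M))))).congr
    fun _ => rfl

/-! ## The greedy fold -/

/-- The clash test. -/
theorem codeFP_clash : CodeFP (pairE tripE tripE) bitE (fun t => clash t.1 t.2) := by
  have a1 : CodeFP (pairE tripE tripE) natE (fun t => t.1.1) := (fst _ _).fst'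
  have a2 : CodeFP (pairE tripE tripE) natE (fun t => t.1.2.1) := (fst _ _).snd'.fst'
  have a3 : CodeFP (pairE tripE tripE) natE (fun t => t.1.2.2) := (fst _ _).snd'.snd'
  have b1 : CodeFP (pairE tripE tripE) natE (fun t => t.2.1) := (snd _ _).fst'
  have b2 : CodeFP (pairE tripE tripE) natE (fun t => t.2.2.1) := (snd _ _).snd'.fst'
  have b3 : CodeFP (pairE tripE tripE) natE (fun t => t.2.2.2) := (snd _ _).snd'.snd'
  exact (((((codeFP_eqTest a1 b1).or (codeFP_eqTest a2 b2)).or (codeFP_eqTest a2 b3)).or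
    (codeFP_eqTest a3 b2)).or (codeFP_eqTest a3 b3)).congr fun _ => rfl

/-- The greedy step (arguments swapped for `foldl₀`). -/
theorem codeFP_gstep : CodeFP (pairE tripE chE) chE (fun t => gstep t.2 t.1) := by
  have hany : CodeFP (pairE tripE chE) bitE (fun t => t.2.any fun q => clash q t.1) :=
    any (p := fun s : (ℕ × ℕ × ℕ) × (ℕ × ℕ × ℕ) => clash s.2 s.1) (codeFP_clash.comp ((snd _ _).pair (fst _ _)))
  exact (hany.ite (snd _ _) ((rawAppend tripE).comp ((snd _ _).pair ((rawSingleton tripE).comp (fst _ _))))).congr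
    fun _ => rfl

/-- The greedy fold: the accumulator is a sublist of the input. -/
theorem codeFP_greedy : CodeFP chE chE greedy := by
  have h := foldl₀ (α := ℕ × ℕ × ℕ) (β := List (ℕ × ℕ × ℕ)) (eα := tripE) (eβ := chE)
    (step := fun a b => gstep b a) (b₀ := []) codeFP_gstep Polynomial.X (fun l₁ l₂ => by
      rw [Polynomial.eval_X]
      have hsub : (l₁.foldl (fun b a => gstep b a) []).Sublist (l₁ ++ l₂) :=
        (greedy_sublist l₁).trans (List.sublist_append_left l₁ l₂)
      exact length_rawE_le_of_sublist tripE hsub)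
  exact h.congr fun _ => rfl

/-- The chosen cherries. -/
theorem codeFP_cher : CodeFP prE chE cher := (codeFP_greedy.comp codeFP_cherryCands).congr fun _ => rfl

/-! ## Derived lists and tests -/

/-- The forced variables. -/
theorem codeFP_forcedL : CodeFP chE (rawE natE) forcedL := (map₀ (fst _ _)).congr fun _ => rfl

/-- The first edges. -/
theorem codeFP_firstL : CodeFP chE (rawE natE) firstL := (map₀ (snd _ _).fst').congr fun _ => rfl

/-- All cherry edges. -/
theorem codeFP_edgeL : CodeFP chE (rawE natE) edgeL :=
  ((rawAppend natE).comp ((map₀ (snd _ _).fst').pair (map₀ (snd _ _).snd'))).congr fun _ => rfl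

/-- The forced-variable test. -/
theorem codeFP_isF : CodeFP (pairE chE natE) bitE (fun q => isF q.1 q.2) :=
  ((mem natE_injective).comp ((snd _ _).pair (codeFP_forcedL.comp (fst _ _)))).congr fun _ => rfl

/-- The pattern `σ`. -/
theorem codeFP_sig : CodeFP (pairE chE natE) bitE (fun q => sig q.1 q.2) :=
  ((mem natE_injective).comp ((snd _ _).pair (codeFP_firstL.comp (fst _ _)))).congr fun _ => rfl

/-- `isF` applied to a computed cherry list and variable. -/
theorem codeFP_isF' {gc : α → List (ℕ × ℕ × ℕ)} {gu : α → ℕ} (hc : CodeFP eα chE gc) (hu : CodeFP eα natE gu) :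
    CodeFP eα bitE (fun a => isF (gc a) (gu a)) := codeFP_isF.comp (hc.pair hu)

/-- The cover test on the context `((triples, cherries), o)`. -/
theorem codeFP_covB : CodeFP (pairE c1E natE) bitE (fun q => covB q.1.1 q.1.2 q.2) := by
  have hL : CodeFP (pairE c1E natE) (rawE tripE) (fun q => q.1.1) := (fst _ _).fst'
  have hc : CodeFP (pairE c1E natE) chE (fun q => q.1.2) := (fst _ _).snd'
  have ho : CodeFP (pairE c1E natE) natE (fun q => q.2) := snd _ _
  exact ((codeFP_isF' hc (codeFP_tri1 hL ho)).or (codeFP_isF' hc (codeFP_tri2 hL ho))).congr fun _ => rfl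

/-- The covered outputs. -/
theorem codeFP_covL : CodeFP c2E (rawE natE) (fun q => covL q.1 q.2) := by
  have hctx : CodeFP c2E c1E (fun q => (q.1.2.2, q.2)) := (codeFP_trips.comp (fst _ _)).pair (snd _ _)
  have hr : CodeFP c2E (rawE natE) (fun q => List.range q.1.2.1) := urange.comp (codeFP_M.comp (fst _ _))
  exact ((filter codeFP_covB).comp (hctx.pair hr)).congr fun _ => rfl

/-- The affine constant `β` on the context `((triples, cherries), o)`. -/
theorem codeFP_bet : CodeFP (pairE c1E natE) bitE (fun q => bet q.1.1 q.1.2 q.2) := by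
  have hL : CodeFP (pairE c1E natE) (rawE tripE) (fun q => q.1.1) := (fst _ _).fst'
  have hc : CodeFP (pairE c1E natE) chE (fun q => q.1.2) := (fst _ _).snd'
  have ho : CodeFP (pairE c1E natE) natE (fun q => q.2) := snd _ _
  exact (((codeFP_isF' hc (codeFP_tri1 hL ho)).and (codeFP_isF' hc (codeFP_tri2 hL ho))).xor
    (codeFP_isF' hc (codeFP_tri0 hL ho))).congr fun _ => rfl

/-- The column test on the context `(((triples, cherries), v), o)`. -/
theorem codeFP_colB : CodeFP (pairE (pairE c1E natE) natE) bitE (fun q => colB q.1.1.1 q.1.1.2 q.1.2 q.2) := by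
  have hL : CodeFP (pairE (pairE c1E natE) natE) (rawE tripE) (fun q => q.1.1.1) := (fst _ _).fst'.fst'
  have hc : CodeFP (pairE (pairE c1E natE) natE) chE (fun q => q.1.1.2) := (fst _ _).fst'.snd'
  have hv : CodeFP (pairE (pairE c1E natE) natE) natE (fun q => q.1.2) := (fst _ _).snd'
  have ho : CodeFP (pairE (pairE c1E natE) natE) natE (fun q => q.2) := snd _ _
  exact (((codeFP_eqTest (codeFP_tri0 hL ho) hv).or
    ((codeFP_eqTest (codeFP_tri1 hL ho) hv).and (codeFP_isF' hc (codeFP_tri2 hL ho)))).or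
    ((codeFP_eqTest (codeFP_tri2 hL ho) hv).and (codeFP_isF' hc (codeFP_tri1 hL ho)))).congr fun _ => rfl

/-- One column, on the context `((raw instance, cherries), v)`. -/
theorem codeFP_colL : CodeFP (pairE c2E natE) (rawE natE) (fun q => colL q.1.1 q.1.2 q.2) := by
  have hctx : CodeFP (pairE c2E natE) (pairE c1E natE)
      (fun q => (((q.1.1.2.2, q.1.2), q.2))) :=
    (((codeFP_trips.comp (fst _ _).fst').pair (fst _ _).snd').pair (snd _ _))
  have hcov : CodeFP (pairE c2E natE) (rawE natE) (fun q => covL q.1.1 q.1.2) := codeFP_covL.comp (fst _ _)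
  exact ((filter codeFP_colB).comp (hctx.pair hcov)).congr fun _ => rfl

/-- The columns of the unforced variables. -/
theorem codeFP_cols : CodeFP c2E (rawE (rawE natE)) (fun q => cols q.1 q.2) := by
  have hunf : CodeFP c2E (rawE natE) (fun q => (List.range q.1.1).filter fun v => !isF q.2 v) :=
    ((filter (codeFP_isF.not)).comp ((snd _ _).pair (urange.comp (codeFP_N.comp (fst _ _))))).congr fun _ => rfl
  exact ((map codeFP_colL).comp ((CodeFP.id c2E).pair hunf)).congr fun _ => rfl

/-- The test vector of a flip set, on the context `((raw instance, cherries), S)`. -/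
theorem codeFP_tvec : CodeFP (pairE c2E (rawE natE)) (rawE natE) (fun q => tvec q.1.1 q.1.2 q.2) := by
  -- the filter predicate sees `(((triples, cherries), S), o)`
  have hc : CodeFP (pairE (pairE c1E (rawE natE)) natE) chE (fun q => q.1.1.2) := (fst _ _).fst'.snd'
  have hS : CodeFP (pairE (pairE c1E (rawE natE)) natE) (rawE natE) (fun q => q.1.2) := (fst _ _).snd'
  have ho : CodeFP (pairE (pairE c1E (rawE natE)) natE) natE (fun q => q.2) := snd _ _
  have hsig : CodeFP (pairE (pairE c1E (rawE natE)) natE) bitE (fun q => sig q.1.1.2 q.2) := codeFP_sig.comp (hc.pair ho)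
  have hmem : CodeFP (pairE (pairE c1E (rawE natE)) natE) bitE (fun q => decide (q.2 ∈ q.1.2)) :=
    (mem natE_injective).comp (ho.pair hS)
  have hbet : CodeFP (pairE (pairE c1E (rawE natE)) natE) bitE (fun q => bet q.1.1.1 q.1.1.2 q.2) :=
    codeFP_bet.comp ((fst _ _).fst'.pair ho)
  have hp := (hsig.xor hmem).xor hbet
  have hctx : CodeFP (pairE c2E (rawE natE)) (pairE c1E (rawE natE))
      (fun q => ((q.1.1.2.2, q.1.2), q.2)) :=
    ((codeFP_trips.comp (fst _ _).fst').pair (fst _ _).snd').pair (snd _ _)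
  have hcov : CodeFP (pairE c2E (rawE natE)) (rawE natE) (fun q => covL q.1.1 q.1.2) := codeFP_covL.comp (fst _ _)
  exact ((filter hp).comp (hctx.pair hcov)).congr fun _ => rfl

/-- The flip sets. -/
theorem codeFP_kers : CodeFP c2E (rawE (rawE natE)) (fun q => kers q.1 q.2) := by
  have hnon : CodeFP c2E (rawE natE) (fun q => (covL q.1 q.2).filter fun o => !decide (o ∈ edgeL q.2)) := by
    have hp : CodeFP (pairE chE natE) bitE (fun s => !decide (s.2 ∈ edgeL s.1)) :=
      ((mem natE_injective).comp ((snd _ _).pair (codeFP_edgeL.comp (fst _ _)))).not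
    exact ((filter hp).comp ((snd _ _).pair codeFP_covL)).congr fun _ => rfl
  have hA : CodeFP c2E (rawE (rawE natE))
      (fun q => ((covL q.1 q.2).filter fun o => !decide (o ∈ edgeL q.2)).map fun o => [o]) :=
    (map₀ (rawSingleton natE)).comp hnon
  have hpairL : CodeFP tripE (rawE natE) (fun q => [q.2.1, q.2.2]) :=
    ((rawCons natE).comp ((snd _ _).fst'.pair ((rawSingleton natE).comp (snd _ _).snd'))).congr fun _ => rfl
  have hB : CodeFP c2E (rawE (rawE natE)) (fun q => q.2.map fun c => [c.2.1, c.2.2]) := (map₀ hpairL).comp (snd _ _)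
  exact ((rawCons (rawE natE)).comp ((const c2E ([] : List ℕ)).pair ((rawAppend (rawE natE)).comp (hA.pair hB)))).congr
    fun _ => rfl

/-- The chosen flip set. -/
theorem codeFP_pick : CodeFP c2E (rawE natE) (fun q => pick q.1 q.2) := by
  have htest : CodeFP (pairE c2E (rawE natE)) bitE
      (fun q => !inSpan q.1.1.2.1 (cols q.1.1 q.1.2) (tvec q.1.1 q.1.2 q.2)) :=
    (codeFP_inSpan.comp ((codeFP_M.comp (fst _ _).fst').pair ((codeFP_cols.comp (fst _ _)).pair codeFP_tvec))).not
  have hfind : CodeFP c2E (optE (rawE natE))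
      (fun q => (kers q.1 q.2).find? fun S => !inSpan q.1.2.1 (cols q.1 q.2) (tvec q.1 q.2 S)) :=
    ((rawFind? htest).comp ((CodeFP.id c2E).pair codeFP_kers)).congr fun _ => rfl
  exact ((optGetD (rawE natE)).comp (hfind.pair (const c2E ([] : List ℕ)))).congr fun _ => rfl

/-- The main answer, given the cherries. -/
theorem codeFP_mainOutW : CodeFP c2E (rawE bitE) (fun q => mainOutW q.1 q.2) := by
  have hg : CodeFP (pairE (pairE chE (rawE natE)) natE) bitE (fun s => sig s.1.1 s.2 ^^ decide (s.2 ∈ s.1.2)) :=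
    (codeFP_sig.comp ((fst _ _).fst'.pair (snd _ _))).xor ((mem natE_injective).comp ((snd _ _).pair (fst _ _).snd'))
  have hctx : CodeFP c2E (pairE chE (rawE natE)) (fun q => (q.2, pick q.1 q.2)) := (snd _ _).pair codeFP_pick
  have hr : CodeFP c2E (rawE natE) (fun q => List.range q.1.2.1) := urange.comp (codeFP_M.comp (fst _ _))
  exact ((map hg).comp (hctx.pair hr)).congr fun _ => rfl

/-- The main answer. -/
theorem codeFP_mainOut : CodeFP prE (rawE bitE) mainOut :=
  (codeFP_mainOutW.comp ((CodeFP.id prE).pair codeFP_cher)).congr fun _ => rfl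

/-- **The tangled-surplus solver is polynomial time on raw pure instances.** -/
theorem codeFP_starOut : CodeFP prE (rawE bitE) starOut := by
  have hsome : CodeFP (pairE prE pE) (rawE bitE) (fun t => indic t.1.2.1 [t.2.1]) :=
    codeFP_indic.comp ((codeFP_M.comp (fst _ _)).pair ((rawSingleton natE).comp (snd _ _).fst'))
  have hk := optCases (σ := PRaw) (eσ := prE) (eα := pE) (eδ := rawE bitE) (k := starDispatch)
    (gnone := mainOut) (gsome := fun t => indic t.1.2.1 [t.2.1]) codeFP_mainOut hsome
    (fun _ => rfl) (fun _ _ => rfl)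
  exact (hk.comp ((CodeFP.id prE).pair codeFP_findPar)).congr fun _ => rfl

end Summit.PneNP.PneNP.Theorems.Nc03CandStar
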